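import Summits.QuantumFields.YangMills.Theorems.SwapVirialDeficitZeroModeSigmaFourSmallBallPointwise
import Summits.QuantumFields.YangMills.Theorems.SwapVirialDeficitZeroModeSigmaFourSmallBallHub
import HarnessLib

/-!
# Exact zero-mode rung Z5 — the σ-TWISTED FOUR-LEADER small ball, V: THE LIMIT `Haar⁴(E_σ(t))/t⁷ → v₇ > 0`
# (LEAD ym-line-sfw-p2 g93 07:46Z «the zero-mode inputs a sharp law needs next are EXACT small-ball asymptotics … `Haar⁴{E_σ(t)} = v₇t⁷(1+O(t^θ))`»;
# free-hands support of ⟨stmt-QuantumFields-24197⟩ `SwapVirialDeficit.SwapGluedStiffness`)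

★★★ `sigmaBall_smallBall_limit : ∃ v : ℝ, 0 < v ∧ Tendsto (fun t => (Haar⁴ (sigmaBall t)).toReal / t ^ 7) (𝓝[>] 0) (𝓝 v)` — the σ-TWISTED
FOUR-LEADER ZERO-MODE BLOCK OF THE SWAP-GLUED FEMTO RING IS REGULAR: the product-Haar mass of the quadruples of `SU(2)` obeying the relations of
`π₁ = ℤ³ ⋊_σ ℤ` up to `t` (the exact event of ✓`haar_pi_sigmaTwisted_ge` / ✓`haar_pi_sigmaTwisted_le`, two-sided `≍ t⁷`) has an honest LIMIT
`v₇ = lim Haar⁴(E_σ(t))/t⁷ ∈ (0, ∞)` — exponent `7` = codimension of the torus stratum, multiplicity one, no logarithm (the Weyl stratum has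
codimension `8` and dies).  Assembly of parts I–IV (cone model, hub straightening, slaved-letter translation, exact `t⁷`, dominator from the four
load-bearing constraints of LEAD g93's ceiling, its integrability — no log) and III (slopes of the six relation maps):
* §31 a threshold `r ∈ (0, 1]` off the countably many levels charged by the six derivative norms `‖L_i‖` (✓`Measure.countable_meas_level_set_pos` on the
  s-finite measure `cone ⊗ vol³`) — NO boundary geometry is computed;
* §32 dominated convergence on `cone ⊗ vol³` along the scale `s = t/r` (✓`tendsto_lintegral_filter_of_dominated_convergence`): measurability of the
  joint events, domination for `s ≤ 1` (parts III-a/IV-a), integrable bound (IV-c), a.e. convergence (III-b; the exceptional sets are coordinate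
  hyperplanes/spheres ✓`volume_normZero_eq_one_null`, ✓`volume_re_sq_eq_null`, ✓`volume_re_eq_zero`, and the null `r`-levels);
* §33 the limit: `Haar⁴(E_σ(t))/t⁷ = r⁻⁷·coneConst³·∫vol³(rescaledSigmaR r (t/r) A(a))dcone(a) → v₇ := r⁻⁷·(coneConst³·μ(lim))`, finite by the
  dominator and POSITIVE by w2 g54's floor ✓`SigmaTwistedLetterFloor.haar_pi_sigmaTwisted_ge` (`c·t⁷ ≤ Haar⁴`); `v₇` is an explicit cone integral of the
  limit event `limSigma r`.
HONEST LABEL: a finite-dimensional Haar-volume ASYMPTOTIC on `SU(2)⁴` (plan-level zero-mode rung of the DRAFT line «sharp-sigma» for the sharp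
principal-class law); NOT the fixed-`L` sharp law `SharpSwapVolumeLaw`, NOT ⟨24197⟩/⟨24194⟩; no rate `O(t^θ)` claimed; own crux ⟨22884⟩ OPEN
(blocked-on ⟨19935⟩); the Yang–Mills mass gap is NOT proved; no summit is proved by a line.
Width seat ym-line-sfw-p2-w3 g63 (cell ym-idea-1, free hands), `--supports stmt-QuantumFields-24197`.  THEOREMS ONLY, standard axioms, 0 `sorry`.
References: [cite: GonzalezarroyoAltes1988]; [cite: Vanbaal2001]; [cite: Luscher1983, §2]; [folklore].
-/

set_option autoImplicit false

noncomputable section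

open MeasureTheory Quaternion Set Filter Topology
open scoped Quaternion ENNReal BigOperators
open Literature.MathematicalPhysics.QuantumLattice
open Literature.MathematicalPhysics.QuantumFieldTheory (haarProbability)
open Literature.Analysis.Calculus (radialUnit radialUnit_def norm_radialUnit)
open Summit.QuantumFields.YangMills.Theorems.SwapTwistDeficit.ToronLog
open Summit.QuantumFields.YangMills.Theorems.SwapVirialDeficit.ZeroModeGroup

attribute [local instance] Literature.Analysis.FluidPDE.Tao2016.quatMeasurableSpace
  Literature.Analysis.FluidPDE.Tao2016.quatBorelSpace
  Literature.MathematicalPhysics.QuantumLattice.secondCountableTopology_su2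

namespace Summit.QuantumFields.YangMills.Theorems.SwapVirialDeficit.ZeroModeSigma

/-! ## §31 The blow-up measure and a good threshold -/

/-- Lebesgue measure of the three non-hub letters. [folklore] -/
def vol3 : Measure ((ℍ × ℍ) × ℍ) := ((volume : Measure ℍ).prod volume).prod volume

/-- `vol3` unfolded. [folklore] -/
theorem vol3_def : vol3 = ((volume : Measure ℍ).prod volume).prod volume := rfl

/-- `vol3` is s-finite. [folklore] -/
theorem sFinite_vol3 : SFinite vol3 := by rw [vol3_def]; infer_instance

/-- The blow-up measure `cone ⊗ vol³` on (hub, letters). [folklore] -/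
def blowUp : Measure (ℍ × ((ℍ × ℍ) × ℍ)) := coneMeasure.prod vol3

/-- `blowUp` unfolded. [folklore] -/
theorem blowUp_def : blowUp = coneMeasure.prod (((volume : Measure ℍ).prod volume).prod volume) := rfl

/-- `blowUp` is s-finite (indeed σ-finite). [folklore] -/
theorem sFinite_blowUp : SFinite blowUp := by
  haveI := isProbabilityMeasure_coneMeasure
  haveI := sFinite_vol3
  rw [blowUp]; infer_instance

/-- ★ **A good threshold**: some `r ∈ (0, 1]` charges none of the six levels `{‖L_i‖ = r}` (all but countably many `r` do). [folklore] -/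
theorem exists_good_threshold : ∃ r : ℝ, 0 < r ∧ r ≤ 1 ∧
    ∀ i : Fin 6, blowUp {q : ℍ × ((ℍ × ℍ) × ℍ) | ‖Lrel (radialUnit (axisPoint q.1)) q.2.1.1 q.2.1.2 q.2.2 i‖ = r} = 0 := by
  haveI := sFinite_blowUp
  set C : Set ℝ := ⋃ i : Fin 6, {t : ℝ | 0 < blowUp {q : ℍ × ((ℍ × ℍ) × ℍ) | ‖Lrel (radialUnit (axisPoint q.1)) q.2.1.1 q.2.1.2 q.2.2 i‖ = t}} with hC
  have hCc : C.Countable := Set.countable_iUnion fun i => Measure.countable_meas_level_set_pos ((measurable_Lrel_hub i).norm)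
  have hC0 : (volume : Measure ℝ) C = 0 := hCc.measure_zero _
  have hns : ¬ (Set.Ioc (0:ℝ) 1 ⊆ C) := by
    intro h
    have h1 : (volume : Measure ℝ) (Set.Ioc (0:ℝ) 1) ≤ 0 := (measure_mono h).trans hC0.le
    rw [Real.volume_Ioc] at h1
    norm_num at h1
  obtain ⟨r, ⟨hr0, hr1⟩, hrC⟩ := Set.not_subset.1 hns
  refine ⟨r, hr0, hr1, fun i => ?_⟩
  by_contra hne0
  exact hrC (Set.mem_iUnion.2 ⟨i, pos_iff_ne_zero.2 hne0⟩)

/-! ## §32 Dominated convergence along the scale -/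

/-- The joint rescaled event `{(a, w) | w ∈ rescaledSigmaR r s A(a)}` is measurable. [folklore] -/
theorem measurableSet_rescaledSigmaR_hub (r s : ℝ) :
    MeasurableSet {q : ℍ × ((ℍ × ℍ) × ℍ) | q.2 ∈ rescaledSigmaR r s (radialUnit (axisPoint q.1))} := by
  have hA : Measurable fun q : ℍ × ((ℍ × ℍ) × ℍ) => radialUnit (axisPoint q.1) := measurable_axisUnit.comp measurable_fst
  have hD : Measurable fun q : ℍ × ((ℍ × ℍ) × ℍ) => dil3 s q.2 := (measurable_dil3 s).comp measurable_snd
  have hx : Measurable fun q : ℍ × ((ℍ × ℍ) × ℍ) => (dil3 s q.2).1.1 := measurable_fst.comp (measurable_fst.comp hD)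
  have hy : Measurable fun q : ℍ × ((ℍ × ℍ) × ℍ) => (dil3 s q.2).1.2 := measurable_snd.comp (measurable_fst.comp hD)
  have hz : Measurable fun q : ℍ × ((ℍ × ℍ) × ℍ) => (dil3 s q.2).2 := measurable_snd.comp hD
  have hJ : MeasurableSet ({q : ℍ × ((ℍ × ℍ) × ℍ) |
      (radialUnit (dil3 s q.2).1.1, slaveP (radialUnit (axisPoint q.1)) (dil3 s q.2).1.1 * radialUnit (dil3 s q.2).2,
        radialUnit (dil3 s q.2).1.2, radialUnit (axisPoint q.1)) ∈ sigmaSet (r * s)} ∩ {q | dil3 s q.2 ∈ ball3}) :=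
    (measurableSet_preimage_sigmaSet _ (measurable_radialUnit.comp hx) ((measurable_slaveP.comp (hA.prodMk hx)).mul (measurable_radialUnit.comp hz))
      (measurable_radialUnit.comp hy) hA).inter (measurableSet_ball3.preimage hD)
  have e : {q : ℍ × ((ℍ × ℍ) × ℍ) | q.2 ∈ rescaledSigmaR r s (radialUnit (axisPoint q.1))} = {q : ℍ × ((ℍ × ℍ) × ℍ) |
      (radialUnit (dil3 s q.2).1.1, slaveP (radialUnit (axisPoint q.1)) (dil3 s q.2).1.1 * radialUnit (dil3 s q.2).2,
        radialUnit (dil3 s q.2).1.2, radialUnit (axisPoint q.1)) ∈ sigmaSet (r * s)} ∩ {q | dil3 s q.2 ∈ ball3} := by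
    ext q; simp only [Set.mem_setOf_eq, Set.mem_inter_iff, rescaledSigmaR, Set.mem_preimage, mem_transSet_iff, dil3_apply]
  rw [e]; exact hJ

/-- The hub integral as an integral against `blowUp`. [folklore] -/
theorem lintegral_volume_rescaledSigmaR_eq (r s : ℝ) :
    ∫⁻ a, vol3 (rescaledSigmaR r s (radialUnit (axisPoint a))) ∂coneMeasure =
      ∫⁻ q, {q : ℍ × ((ℍ × ℍ) × ℍ) | q.2 ∈ rescaledSigmaR r s (radialUnit (axisPoint q.1))}.indicator (1 : ℍ × ((ℍ × ℍ) × ℍ) → ℝ≥0∞) q ∂blowUp := by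
  haveI := isProbabilityMeasure_coneMeasure
  haveI := sFinite_blowUp
  haveI := sFinite_vol3
  rw [lintegral_indicator_one (measurableSet_rescaledSigmaR_hub r s), blowUp, Measure.prod_apply (measurableSet_rescaledSigmaR_hub r s)]
  rfl

/-- Almost every point of the blow-up space is good for the pointwise limit at a good threshold `r`. [folklore] -/
theorem ae_blowUp_good {r : ℝ} (hgood : ∀ i : Fin 6, blowUp {q : ℍ × ((ℍ × ℍ) × ℍ) | ‖Lrel (radialUnit (axisPoint q.1)) q.2.1.1 q.2.1.2 q.2.2 i‖ = r} = 0) :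
    ∀ᵐ q : ℍ × ((ℍ × ℍ) × ℍ) ∂blowUp, q.1 ≠ 0 ∧ axPart q.2.1.1 ≠ 0 ∧ axPart q.2.1.2 ≠ 0 ∧ q.2.2.re ≠ 0 ∧
      ‖axPart q.2.1.1‖ ≠ 1 ∧ ‖axPart q.2.1.2‖ ≠ 1 ∧ ‖(q.2.2.re : ℍ)‖ ≠ 1 ∧ q.2.1.1 ≠ 0 ∧
      ∀ i : Fin 6, ‖Lrel (radialUnit (axisPoint q.1)) q.2.1.1 q.2.1.2 q.2.2 i‖ ≠ r := by
  haveI := isProbabilityMeasure_coneMeasure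
  haveI := sFinite_blowUp
  -- null sets of one quaternion letter
  have hre0 : ∀ᵐ x : ℍ ∂(volume : Measure ℍ), x.re ≠ 0 := by
    rw [ae_iff]; simpa only [ne_eq, not_not] using Literature.MathematicalPhysics.QuantumLattice.volume_re_eq_zero
  have hax0 : ∀ᵐ x : ℍ ∂(volume : Measure ℍ), axPart x ≠ 0 := by
    filter_upwards [hre0] with x hx h0
    exact hx (by have := congrArg (fun q : ℍ => q.re) h0; simpa [axPart] using this)
  have hax1 : ∀ᵐ x : ℍ ∂(volume : Measure ℍ), ‖axPart x‖ ≠ 1 := by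
    have h : (volume : Measure ℍ) {x : ℍ | dilNormSq 0 x = 1} = 0 := volume_normZero_eq_one_null
    have h' : ∀ᵐ x : ℍ ∂(volume : Measure ℍ), dilNormSq 0 x ≠ 1 := by rw [ae_iff]; simpa only [ne_eq, not_not] using h
    filter_upwards [h'] with x hx h1
    apply hx
    have h2 : ‖axPart x‖ ^ 2 = x.re ^ 2 + x.imI ^ 2 := by rw [sq_norm_eq_sum_sq]; simp [axPart]
    rw [dilNormSq_zero, ← h2, h1, one_pow]
  have hzre1 : ∀ᵐ z : ℍ ∂(volume : Measure ℍ), ‖(z.re : ℍ)‖ ≠ 1 := by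
    have h : (volume : Measure ℍ) {z : ℍ | z.re ^ 2 = (fun _ : Fin 3 → ℝ => (1:ℝ)) ![z.imI, z.imJ, z.imK]} = 0 := volume_re_sq_eq_null measurable_const
    have h' : ∀ᵐ z : ℍ ∂(volume : Measure ℍ), z.re ^ 2 ≠ 1 := by rw [ae_iff]; simpa only [ne_eq, not_not] using h
    filter_upwards [h'] with z hz h1
    apply hz
    rw [Quaternion.norm_coe, Real.norm_eq_abs] at h1
    nlinarith [sq_abs z.re, h1]
  -- lift to the blow-up space
  have hQ1 : Measure.QuasiMeasurePreserving (fun q : ℍ × ((ℍ × ℍ) × ℍ) => q.1) blowUp coneMeasure := by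
    rw [blowUp]; exact Measure.quasiMeasurePreserving_fst
  have hQ2 : Measure.QuasiMeasurePreserving (fun q : ℍ × ((ℍ × ℍ) × ℍ) => q.2) blowUp vol3 := by
    rw [blowUp]; exact Measure.quasiMeasurePreserving_snd
  have hQx : Measure.QuasiMeasurePreserving (fun w : (ℍ × ℍ) × ℍ => w.1.1) vol3 volume := by
    rw [vol3_def]; exact Measure.quasiMeasurePreserving_fst.comp Measure.quasiMeasurePreserving_fst
  have hQy : Measure.QuasiMeasurePreserving (fun w : (ℍ × ℍ) × ℍ => w.1.2) vol3 volume := by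
    rw [vol3_def]; exact Measure.quasiMeasurePreserving_snd.comp Measure.quasiMeasurePreserving_fst
  have hQz : Measure.QuasiMeasurePreserving (fun w : (ℍ × ℍ) × ℍ => w.2) vol3 volume := by
    rw [vol3_def]; exact Measure.quasiMeasurePreserving_snd
  have h1 : ∀ᵐ q : ℍ × ((ℍ × ℍ) × ℍ) ∂blowUp, q.1 ≠ 0 := hQ1.ae ae_ne_zero_coneMeasure
  have h2 : ∀ᵐ q : ℍ × ((ℍ × ℍ) × ℍ) ∂blowUp, axPart q.2.1.1 ≠ 0 := hQ2.ae (hQx.ae hax0)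
  have h3 : ∀ᵐ q : ℍ × ((ℍ × ℍ) × ℍ) ∂blowUp, axPart q.2.1.2 ≠ 0 := hQ2.ae (hQy.ae hax0)
  have h4 : ∀ᵐ q : ℍ × ((ℍ × ℍ) × ℍ) ∂blowUp, q.2.2.re ≠ 0 := hQ2.ae (hQz.ae hre0)
  have h5 : ∀ᵐ q : ℍ × ((ℍ × ℍ) × ℍ) ∂blowUp, ‖axPart q.2.1.1‖ ≠ 1 := hQ2.ae (hQx.ae hax1)
  have h6 : ∀ᵐ q : ℍ × ((ℍ × ℍ) × ℍ) ∂blowUp, ‖axPart q.2.1.2‖ ≠ 1 := hQ2.ae (hQy.ae hax1)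
  have h7 : ∀ᵐ q : ℍ × ((ℍ × ℍ) × ℍ) ∂blowUp, ‖(q.2.2.re : ℍ)‖ ≠ 1 := hQ2.ae (hQz.ae hzre1)
  have h8 : ∀ᵐ q : ℍ × ((ℍ × ℍ) × ℍ) ∂blowUp, q.2.1.1 ≠ 0 := by
    filter_upwards [h2] with q hq h0
    exact hq (by rw [h0]; rfl)
  have h9 : ∀ᵐ q : ℍ × ((ℍ × ℍ) × ℍ) ∂blowUp, ∀ i : Fin 6, ‖Lrel (radialUnit (axisPoint q.1)) q.2.1.1 q.2.1.2 q.2.2 i‖ ≠ r := by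
    rw [ae_all_iff]; intro i
    rw [ae_iff]; simpa only [ne_eq, not_not] using hgood i
  filter_upwards [h1, h2, h3, h4, h5, h6, h7, h8, h9] with q a b c d e f g h k using ⟨a, b, c, d, e, f, g, h, k⟩

/-- ★★ **DOMINATED CONVERGENCE**: at a good threshold `r ∈ (0,1]`, the hub integrals of the rescaled σ-events converge as the scale `s → 0⁺` to the
measure of the limit event. [folklore] -/
theorem tendsto_lintegral_rescaledSigmaR {r : ℝ} (hr1 : r ≤ 1)
    (hgood : ∀ i : Fin 6, blowUp {q : ℍ × ((ℍ × ℍ) × ℍ) | ‖Lrel (radialUnit (axisPoint q.1)) q.2.1.1 q.2.1.2 q.2.2 i‖ = r} = 0) :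
    Tendsto (fun s : ℝ => ∫⁻ a, vol3 (rescaledSigmaR r s (radialUnit (axisPoint a))) ∂coneMeasure) (𝓝[>] (0:ℝ))
      (𝓝 (∫⁻ q, {q : ℍ × ((ℍ × ℍ) × ℍ) | q.2 ∈ limSigma r (radialUnit (axisPoint q.1))}.indicator (1 : ℍ × ((ℍ × ℍ) × ℍ) → ℝ≥0∞) q ∂blowUp)) := by
  haveI := sFinite_blowUp
  simp only [lintegral_volume_rescaledSigmaR_eq]
  refine tendsto_lintegral_filter_of_dominated_convergence (fun q => sigmaDom (radialUnit (axisPoint q.1)) q.2) ?_ ?_ ?_ ?_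
  · exact Eventually.of_forall fun s => measurable_one.indicator (measurableSet_rescaledSigmaR_hub r s)
  · have hs : ∀ᶠ s in 𝓝[>] (0:ℝ), s ∈ Set.Ioc (0:ℝ) 1 := Ioc_mem_nhdsGT zero_lt_one
    filter_upwards [hs] with s hs
    filter_upwards [ae_blowUp_good hgood] with q hq
    obtain ⟨ha, -, -, -, -, -, -, hx0, -⟩ := hq
    have hsub := rescaledSigmaR_subset hr1 hs.1.le (radialUnit (axisPoint q.1))
    calc {q : ℍ × ((ℍ × ℍ) × ℍ) | q.2 ∈ rescaledSigmaR r s (radialUnit (axisPoint q.1))}.indicator (1 : ℍ × ((ℍ × ℍ) × ℍ) → ℝ≥0∞) q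
        ≤ (rescaledSigma s (radialUnit (axisPoint q.1))).indicator (1 : (ℍ × ℍ) × ℍ → ℝ≥0∞) q.2 := by
          by_cases hm : q.2 ∈ rescaledSigmaR r s (radialUnit (axisPoint q.1))
          · rw [Set.indicator_of_mem (show q ∈ {q : ℍ × ((ℍ × ℍ) × ℍ) | q.2 ∈ rescaledSigmaR r s (radialUnit (axisPoint q.1))} from hm),
              Set.indicator_of_mem (hsub hm), Pi.one_apply, Pi.one_apply]
          · rw [Set.indicator_of_notMem (show q ∉ {q : ℍ × ((ℍ × ℍ) × ℍ) | q.2 ∈ rescaledSigmaR r s (radialUnit (axisPoint q.1))} from hm)]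
            exact bot_le
      _ ≤ sigmaDom (radialUnit (axisPoint q.1)) q.2 := indicator_rescaledSigma_axis_le_sigmaDom hs.1 ha q.2 hx0
  · rw [blowUp_def]; exact lintegral_prod_sigmaDom_ne_top
  · filter_upwards [ae_blowUp_good hgood] with q hq
    obtain ⟨ha, hx, hy, hz, hbx, hby, hbz, -, hL⟩ := hq
    have h := tendsto_indicator_rescaledSigmaR (r := r) (norm_axisUnit ha) (axisUnit_axial q.1).1 (axisUnit_axial q.1).2 hx hy hz hbx hby hbz hL
    refine (tendsto_congr fun s => ?_).2 (h.trans (by rfl))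
    by_cases hm : q.2 ∈ rescaledSigmaR r s (radialUnit (axisPoint q.1))
    · rw [Set.indicator_of_mem (show q ∈ {q : ℍ × ((ℍ × ℍ) × ℍ) | q.2 ∈ rescaledSigmaR r s (radialUnit (axisPoint q.1))} from hm),
        Set.indicator_of_mem hm, Pi.one_apply, Pi.one_apply]
    · rw [Set.indicator_of_notMem (show q ∉ {q : ℍ × ((ℍ × ℍ) × ℍ) | q.2 ∈ rescaledSigmaR r s (radialUnit (axisPoint q.1))} from hm),
        Set.indicator_of_notMem hm]

/-- The limit mass is finite (bounded by the integral of the dominator). [folklore] -/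
theorem limSigma_mass_ne_top {r : ℝ} (hr1 : r ≤ 1)
    (hgood : ∀ i : Fin 6, blowUp {q : ℍ × ((ℍ × ℍ) × ℍ) | ‖Lrel (radialUnit (axisPoint q.1)) q.2.1.1 q.2.1.2 q.2.2 i‖ = r} = 0) :
    ∫⁻ q, {q : ℍ × ((ℍ × ℍ) × ℍ) | q.2 ∈ limSigma r (radialUnit (axisPoint q.1))}.indicator (1 : ℍ × ((ℍ × ℍ) × ℍ) → ℝ≥0∞) q ∂blowUp ≠ ∞ := by
  have hT := tendsto_lintegral_rescaledSigmaR hr1 hgood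
  have hB : ∫⁻ q, sigmaDom (radialUnit (axisPoint q.1)) q.2 ∂blowUp ≠ ∞ := by rw [blowUp_def]; exact lintegral_prod_sigmaDom_ne_top
  refine ne_top_of_le_ne_top hB (le_of_tendsto hT ?_)
  have hs : ∀ᶠ s in 𝓝[>] (0:ℝ), s ∈ Set.Ioc (0:ℝ) 1 := Ioc_mem_nhdsGT zero_lt_one
  filter_upwards [hs] with s hs
  rw [lintegral_volume_rescaledSigmaR_eq]
  refine lintegral_mono_ae ?_
  filter_upwards [ae_blowUp_good hgood] with q hq
  obtain ⟨ha, -, -, -, -, -, -, hx0, -⟩ := hq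
  have hsub := rescaledSigmaR_subset hr1 hs.1.le (radialUnit (axisPoint q.1))
  calc {q : ℍ × ((ℍ × ℍ) × ℍ) | q.2 ∈ rescaledSigmaR r s (radialUnit (axisPoint q.1))}.indicator (1 : ℍ × ((ℍ × ℍ) × ℍ) → ℝ≥0∞) q
      ≤ (rescaledSigma s (radialUnit (axisPoint q.1))).indicator (1 : (ℍ × ℍ) × ℍ → ℝ≥0∞) q.2 := by
        by_cases hm : q.2 ∈ rescaledSigmaR r s (radialUnit (axisPoint q.1))
        · rw [Set.indicator_of_mem (show q ∈ {q : ℍ × ((ℍ × ℍ) × ℍ) | q.2 ∈ rescaledSigmaR r s (radialUnit (axisPoint q.1))} from hm),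
            Set.indicator_of_mem (hsub hm), Pi.one_apply, Pi.one_apply]
        · rw [Set.indicator_of_notMem (show q ∉ {q : ℍ × ((ℍ × ℍ) × ℍ) | q.2 ∈ rescaledSigmaR r s (radialUnit (axisPoint q.1))} from hm)]
          exact bot_le
    _ ≤ sigmaDom (radialUnit (axisPoint q.1)) q.2 := indicator_rescaledSigma_axis_le_sigmaDom hs.1 ha q.2 hx0

/-! ## §33 The small-ball limit -/

/-- ★ **The quotient at scale `s = t/r`**: `Haar⁴(E_σ(t))/t⁷ = (r⁷)⁻¹·(coneConst³·∫ vol³(rescaledSigmaR r (t/r) A(a)) dcone(a)).toReal` (`t, r > 0`).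
[folklore] -/
theorem haar_sigmaBall_div_eq_R {r t : ℝ} (hr : 0 < r) (ht : 0 < t) :
    ((Measure.pi fun _ : Fin 4 => haarProbability (Matrix.specialUnitaryGroup (Fin 2) ℂ)) (sigmaBall t)).toReal / t ^ 7 =
      (r ^ 7)⁻¹ * (ENNReal.ofReal coneConst ^ 3 * ∫⁻ a, vol3 (rescaledSigmaR r (t / r) (radialUnit (axisPoint a))) ∂coneMeasure).toReal := by
  have hs : 0 < t / r := div_pos ht hr
  have e : t = r * (t / r) := by field_simp
  conv_lhs => rw [e]
  rw [haar_sigmaBall_eq_scaledR hr.le hs, ENNReal.toReal_mul, ENNReal.toReal_ofReal (by positivity)]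
  rw [← e]
  have h7 : t ^ 7 ≠ 0 := by positivity
  have hr7 : r ^ 7 ≠ 0 := by positivity
  rw [div_pow]
  field_simp
  rfl

/-- ★★★ **THE σ-TWISTED FOUR-LEADER SMALL-BALL LIMIT.**  There is `v > 0` with `Haar⁴(E_σ(t))/t⁷ → v` as `t → 0⁺`, where `E_σ(t) = sigmaBall t` is the
exact event of ✓`haar_pi_sigmaTwisted_ge` / ✓`haar_pi_sigmaTwisted_le` (the six relations of `ℤ³ ⋊_σ ℤ` up to `t` for four Haar letters of `SU(2)`).
The zero-mode block of the swap-glued femto ring at its torus stratum is regular: exponent `7`, multiplicity one, NO logarithm, honest limit.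
[folklore] -/
theorem sigmaBall_smallBall_limit :
    ∃ v : ℝ, 0 < v ∧ Tendsto (fun t : ℝ =>
      ((Measure.pi fun _ : Fin 4 => haarProbability (Matrix.specialUnitaryGroup (Fin 2) ℂ)) (sigmaBall t)).toReal / t ^ 7)
      (𝓝[>] (0:ℝ)) (𝓝 v) := by
  obtain ⟨r, hr0, hr1, hgood⟩ := exists_good_threshold
  set I₀ : ℝ≥0∞ := ∫⁻ q, {q : ℍ × ((ℍ × ℍ) × ℍ) | q.2 ∈ limSigma r (radialUnit (axisPoint q.1))}.indicator (1 : ℍ × ((ℍ × ℍ) × ℍ) → ℝ≥0∞) q ∂blowUp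
    with hI₀
  have hI₀top : I₀ ≠ ∞ := limSigma_mass_ne_top hr1 hgood
  have hT := tendsto_lintegral_rescaledSigmaR hr1 hgood
  set v : ℝ := (r ^ 7)⁻¹ * (ENNReal.ofReal coneConst ^ 3 * I₀).toReal with hv
  -- the scale `s = t/r → 0⁺`
  have hscale : Tendsto (fun t : ℝ => t / r) (𝓝[>] (0:ℝ)) (𝓝[>] (0:ℝ)) := by
    refine tendsto_nhdsWithin_iff.2 ⟨?_, ?_⟩
    · have h : Tendsto (fun t : ℝ => t / r) (𝓝 (0:ℝ)) (𝓝 (0 / r)) := (continuous_id.div_const r).tendsto 0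
      rw [zero_div] at h
      exact h.mono_left nhdsWithin_le_nhds
    · filter_upwards [self_mem_nhdsWithin] with t ht using div_pos ht hr0
  have hcomp : Tendsto (fun t : ℝ => ENNReal.ofReal coneConst ^ 3 * ∫⁻ a, vol3 (rescaledSigmaR r (t / r) (radialUnit (axisPoint a))) ∂coneMeasure)
      (𝓝[>] (0:ℝ)) (𝓝 (ENNReal.ofReal coneConst ^ 3 * I₀)) :=
    ENNReal.Tendsto.const_mul (hT.comp hscale) (Or.inr (ENNReal.pow_ne_top ENNReal.ofReal_ne_top))
  have hreal : Tendsto (fun t : ℝ => (ENNReal.ofReal coneConst ^ 3 * ∫⁻ a, vol3 (rescaledSigmaR r (t / r) (radialUnit (axisPoint a))) ∂coneMeasure).toReal)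
      (𝓝[>] (0:ℝ)) (𝓝 (ENNReal.ofReal coneConst ^ 3 * I₀).toReal) :=
    (ENNReal.tendsto_toReal (ENNReal.mul_ne_top (ENNReal.pow_ne_top ENNReal.ofReal_ne_top) hI₀top)).comp hcomp
  have hlim : Tendsto (fun t : ℝ =>
      ((Measure.pi fun _ : Fin 4 => haarProbability (Matrix.specialUnitaryGroup (Fin 2) ℂ)) (sigmaBall t)).toReal / t ^ 7) (𝓝[>] (0:ℝ)) (𝓝 v) := by
    refine (tendsto_congr' ?_).2 (hreal.const_mul ((r ^ 7)⁻¹))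
    filter_upwards [self_mem_nhdsWithin] with t ht
    exact haar_sigmaBall_div_eq_R hr0 ht
  -- positivity from the floor `c·t⁷ ≤ Haar⁴(E_σ(t))` (w2 g54)
  obtain ⟨c, hc, t₀, ht₀, hlow⟩ := SigmaTwistedLetterFloor.haar_pi_sigmaTwisted_ge
  have hge : ∀ᶠ t in 𝓝[>] (0:ℝ), c ≤ ((Measure.pi fun _ : Fin 4 => haarProbability (Matrix.specialUnitaryGroup (Fin 2) ℂ)) (sigmaBall t)).toReal / t ^ 7 := by
    filter_upwards [Ioc_mem_nhdsGT ht₀] with t ht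
    have h := hlow t ht.1 ht.2
    have h7 : 0 < t ^ 7 := pow_pos ht.1 7
    rw [le_div_iff₀ h7]
    exact h
  exact ⟨v, lt_of_lt_of_le hc (ge_of_tendsto hlim hge), hlim⟩

/-- ★★★ The same with the event written out as in ✓`haar_pi_sigmaTwisted_ge` / ✓`haar_pi_sigmaTwisted_le` (four letters `C : Fin 4 → SU(2)`,
`σ = (0 1)`). [folklore] -/
theorem haar_pi_sigmaTwisted_smallBall_limit :
    ∃ v : ℝ, 0 < v ∧ Tendsto (fun t : ℝ =>
      ((Measure.pi fun _ : Fin 4 => haarProbability (Matrix.specialUnitaryGroup (Fin 2) ℂ))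
        {C : Fin 4 → Matrix.specialUnitaryGroup (Fin 2) ℂ |
          (∀ μ ν : Fin 3, ‖su2Quat (C μ.castSucc) * su2Quat (C ν.castSucc) - su2Quat (C ν.castSucc) * su2Quat (C μ.castSucc)‖ ≤ t) ∧
            ∀ μ : Fin 3, ‖su2Quat (C (Fin.last 3)) * su2Quat (C (Equiv.swap (0 : Fin 3) 1 μ).castSucc) -
              su2Quat (C μ.castSucc) * su2Quat (C (Fin.last 3))‖ ≤ t}).toReal / t ^ 7)
      (𝓝[>] (0:ℝ)) (𝓝 v) :=
  sigmaBall_smallBall_limit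

end Summit.QuantumFields.YangMills.Theorems.SwapVirialDeficit.ZeroModeSigma

end
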